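import Literature.NumberTheory.LFunctions.PsiOscillationFromZero
import Literature.NumberTheory.LFunctions.GeneralizedRH
import HarnessLib

/-!
# LANDAU for the `n^{-1/2}`-weighted dilating statistic `S(x) = Σ_{n ≤ x} Λ(n)/√n` — I: Mellin side

Cell `pub-rhpf` (mechanism/rigidity campaign; **no RH claims**), CAND SEAT 7 gen 8, CASE-DAG v6 §6
kernel target LANDAU, weighted statistic, file 1 of 3 (`…WeightedMellin` → `…Weighted` →
`…WeightedDictionary`). The CASE-DAG row names the weighted statistics
`Σ_{n≤x} Λ(n) n^{-1/2} K(log n / log x)`; these files treat the basic one, `K = 1`: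
`S(x) = Σ_{n≤x} Λ(n) n^{-1/2}` (`wpsi`), main term `2√x`, error `wpsiErr x = S(x) − 2√x`.

This file: the statistic and its Chebyshev-size bounds (§1); its Mellin transform on `Re s > 1`,
`∫_1^∞ S(x) x^{-s-1} dx = ((s − 1/2)⁻¹ − ζ₁'/ζ₁(s + 1/2))/s` and
`∫_1^∞ (S(x) − 2√x) x^{-s-1} dx = −(ζ₁'/ζ₁(s + 1/2) + 2)/s` (§2, from Mathlib's
`LSeries_eq_mul_integral'` for the coefficients `Λ(n) n^{-1/2}`, whose `L`-series is `−ζ'/ζ(s + 1/2)`);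
the comparison function `A = c x^b − η(S − 2√x)`, the shifted kernel `(ζ₁'/ζ₁(s + 1/2) + 2)/s`, its
continuation data and `∫_1^∞ A x^{-s-1} dx = c/(s − b) + η · kernel` on `Re s > 1` (§3) — MV (15.6)
shifted by `1/2`. All RH-free, sorry-free.

References: [MontgomeryVaughan2007] H. L. Montgomery, R. C. Vaughan, *Multiplicative Number Theory I*,
CUP 2007, §15.1 (Lemma 15.1, (15.6), Thm. 15.3), Thm. 1.3.
-/

noncomputable section

-- the sub-problem path RiemannHypothesis/RiemannHypothesis duplicates a namespace (D-0017)
set_option linter.dupNamespace false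

open Complex Filter Topology Set MeasureTheory Metric Asymptotics

namespace Summit.RiemannHypothesis.RiemannHypothesis.Theorems.PfPersistenceDilatingLandauWeightedMellin

open Literature.NumberTheory.LFunctions
open Literature.NumberTheory.LFunctions.Landau

/-- `Re (s + 1/2) = Re s + 1/2`. [folklore] -/
theorem re_add_half (s : ℂ) : (s + 1 / 2).re = s.re + 1 / 2 := by
  have h12 : ((1 / 2 : ℝ) : ℂ) = 1 / 2 := by norm_num
  rw [← h12, add_re, ofReal_re]

/-- `Im (s + 1/2) = Im s`. [folklore] -/
theorem im_add_half (s : ℂ) : (s + 1 / 2).im = s.im := by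
  have h12 : ((1 / 2 : ℝ) : ℂ) = 1 / 2 := by norm_num
  rw [← h12, add_im, ofReal_im, add_zero]

/-! ## §1 The weighted statistic `S(x) = Σ_{n≤x} Λ(n) n^{-1/2}` -/

/-- The coefficient `Λ(k) k^{-1/2}`. [folklore] -/
def wcoef (k : ℕ) : ℝ := ArithmeticFunction.vonMangoldt k / (k : ℝ) ^ (1 / 2 : ℝ)

/-- `S(n) = Σ_{1 ≤ k ≤ n} Λ(k) k^{-1/2}` on naturals. [folklore] -/
def wpsiNat (n : ℕ) : ℝ := ∑ k ∈ Finset.Icc 1 n, wcoef k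

/-- `S(x) = Σ_{n ≤ x} Λ(n) n^{-1/2}`, the `n^{-1/2}`-weighted Chebyshev function (the basic dilating
statistic `Σ_{n≤x} Λ(n) n^{-1/2} K(log n/log x)` with `K = 1`). [folklore] -/
def wpsi (x : ℝ) : ℝ := wpsiNat ⌊x⌋₊

/-- `S(x) − 2√x`, the weighted statistic minus its main term. [folklore] -/
def wpsiErr (x : ℝ) : ℝ := wpsi x - 2 * x ^ (1 / 2 : ℝ)

/-- `Λ(k) k^{-1/2} ≥ 0`. [folklore] -/
theorem wcoef_nonneg (k : ℕ) : 0 ≤ wcoef k :=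
  div_nonneg ArithmeticFunction.vonMangoldt_nonneg (Real.rpow_nonneg (Nat.cast_nonneg k) _)

/-- `Λ(k) k^{-1/2} ≤ Λ(k)` for `k ≥ 1`. [folklore] -/
theorem wcoef_le (k : ℕ) (hk : 1 ≤ k) : wcoef k ≤ ArithmeticFunction.vonMangoldt k :=
  div_le_self ArithmeticFunction.vonMangoldt_nonneg
    (Real.one_le_rpow (by exact_mod_cast hk) (by norm_num))

/-- `S(n) ≥ 0`. [folklore] -/
theorem wpsiNat_nonneg (n : ℕ) : 0 ≤ wpsiNat n := Finset.sum_nonneg fun k _ ↦ wcoef_nonneg k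

/-- `S(n) ≤ ψ(n)`. [folklore] -/
theorem wpsiNat_le_psi (n : ℕ) : wpsiNat n ≤ Chebyshev.psi n := by
  rw [wpsiNat, Chebyshev.psi, Nat.floor_natCast, show (1 : ℕ) = 0 + 1 from rfl,
    Finset.Icc_add_one_left_eq_Ioc]
  exact Finset.sum_le_sum fun k hk ↦ wcoef_le k (Finset.mem_Ioc.1 hk).1

/-- `S(x) ≥ 0`. [folklore] -/
theorem wpsi_nonneg (x : ℝ) : 0 ≤ wpsi x := wpsiNat_nonneg _

/-- `S(x) ≤ ψ(x) ≤ (log 4 + 4) x`. [folklore] -/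
theorem wpsi_le (x : ℝ) (hx : 0 ≤ x) : wpsi x ≤ (Real.log 4 + 4) * x := by
  have h1 : wpsi x ≤ Chebyshev.psi x := by
    rw [wpsi, Chebyshev.psi_eq_psi_coe_floor x]
    exact wpsiNat_le_psi _
  exact h1.trans (Chebyshev.psi_le_const_mul_self hx)

/-- Measurability of `S`. [folklore] -/
theorem measurable_wpsi : Measurable wpsi :=
  (measurable_from_nat (f := wpsiNat)).comp Nat.measurable_floor

/-- `S(x) − 2√x` is measurable. [folklore] -/
theorem measurable_wpsiErr : Measurable wpsiErr :=
  measurable_wpsi.sub (measurable_const.mul (measurable_id.pow_const _))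

/-- `|S(x) − 2√x| ≤ (log 4 + 6) x` for `x > 1`. [folklore] -/
theorem abs_wpsiErr_le {x : ℝ} (hx : 1 < x) : |wpsiErr x| ≤ (Real.log 4 + 6) * x := by
  have hx0 : 0 < x := by linarith
  have hxh : x ^ (1 / 2 : ℝ) ≤ x := by
    calc x ^ (1 / 2 : ℝ) ≤ x ^ (1 : ℝ) := Real.rpow_le_rpow_of_exponent_le hx.le (by norm_num)
      _ = x := Real.rpow_one x
  unfold wpsiErr
  calc |wpsi x - 2 * x ^ (1 / 2 : ℝ)| ≤ |wpsi x| + |2 * x ^ (1 / 2 : ℝ)| := abs_sub _ _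
    _ = wpsi x + 2 * x ^ (1 / 2 : ℝ) := by
        rw [abs_of_nonneg (wpsi_nonneg x), abs_of_nonneg (by positivity)]
    _ ≤ (Real.log 4 + 4) * x + 2 * x := add_le_add (wpsi_le x hx0.le) (by linarith)
    _ = (Real.log 4 + 6) * x := by ring

/-! ## §2 The Mellin transform: `∫_1^∞ S(x) x^{-s-1} dx = −ζ'/ζ(s + 1/2)/s` -/

/-- `Σ_{1 ≤ k ≤ ⌊t⌋} Λ(k)k^{-1/2} = S(t)` (cast to `ℂ`). [folklore] -/
theorem sum_Icc_wcoef_eq_wpsi (t : ℝ) :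
    ∑ k ∈ Finset.Icc 1 ⌊t⌋₊, (wcoef k : ℂ) = (wpsi t : ℂ) := by
  rw [wpsi, wpsiNat]
  push_cast
  rfl

/-- The terms of the `L`-series of `Λ(n) n^{-1/2}` at `s` are those of `Λ` at `s + 1/2`. [folklore] -/
theorem term_wcoef (s : ℂ) (n : ℕ) :
    LSeries.term (fun k ↦ (wcoef k : ℂ)) s n =
      LSeries.term (fun k ↦ (ArithmeticFunction.vonMangoldt k : ℂ)) (s + 1 / 2) n := by
  rcases eq_or_ne n 0 with rfl | hn
  · simp [LSeries.term_zero]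
  have hn' : (n : ℂ) ≠ 0 := Nat.cast_ne_zero.2 hn
  have h1 : (n : ℂ) ^ (1 / 2 : ℂ) ≠ 0 := by
    rw [Ne, Complex.cpow_eq_zero_iff]
    simp [hn]
  rw [LSeries.term_of_ne_zero hn, LSeries.term_of_ne_zero hn, wcoef, Complex.ofReal_div,
    Complex.ofReal_cpow (Nat.cast_nonneg n), Complex.cpow_add _ _ hn']
  push_cast
  rw [div_div, mul_comm]

/-- `L(Λ n^{-1/2}, s) = L(Λ, s + 1/2)`. [folklore] -/
theorem LSeries_wcoef (s : ℂ) :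
    LSeries (fun k ↦ (wcoef k : ℂ)) s =
      LSeries (fun k ↦ (ArithmeticFunction.vonMangoldt k : ℂ)) (s + 1 / 2) :=
  tsum_congr (term_wcoef s)

/-- **MV Theorem 1.3 for `Λ(n)n^{-1/2}`**: for `σ > 1`,
`∫_1^∞ S(x) x^{-(s+1)} dx = ((s − 1/2)^{-1} − ζ₁'/ζ₁(s + 1/2))/s` (`= −ζ'(s+½)/(s ζ(s+½))`).
[cite: MontgomeryVaughan2007, Thm. 1.3] -/
theorem mellinIoi_wpsi {s : ℂ} (hs : 1 < s.re) :
    mellinIoi wpsi s = ((s + 1 / 2 - 1)⁻¹ - logDeriv riemannZeta₁ (s + 1 / 2)) / s := by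
  have hO : (fun n : ℕ ↦ ∑ k ∈ Finset.Icc 1 n, ‖(wcoef k : ℂ)‖) =O[atTop]
      fun n ↦ (n : ℝ) ^ (1 : ℝ) := by
    refine IsBigO.of_bound (Real.log 4 + 4) (Eventually.of_forall fun n ↦ ?_)
    rw [Real.norm_eq_abs, Real.norm_eq_abs, Real.rpow_one, Nat.abs_cast,
      abs_of_nonneg (Finset.sum_nonneg fun k _ ↦ norm_nonneg _)]
    have h1 : ∑ k ∈ Finset.Icc 1 n, ‖(wcoef k : ℂ)‖ = wpsiNat n := by
      rw [wpsiNat]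
      refine Finset.sum_congr rfl fun k _ ↦ ?_
      rw [Complex.norm_real, Real.norm_eq_abs, abs_of_nonneg (wcoef_nonneg k)]
    rw [h1]
    exact (wpsiNat_le_psi n).trans (Chebyshev.psi_le_const_mul_self (Nat.cast_nonneg n))
  have hs' : (1 : ℝ) < s.re := hs
  have hsh : 1 < (s + 1 / 2).re := by rw [re_add_half]; linarith
  have hint := LSeries_eq_mul_integral' (fun k ↦ (wcoef k : ℂ)) zero_le_one hs' hO
  rw [LSeries_wcoef, ArithmeticFunction.LSeries_vonMangoldt_eq_deriv_riemannZeta_div hsh] at hint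
  simp_rw [sum_Icc_wcoef_eq_wpsi] at hint
  have hs1 : s + 1 / 2 ≠ 1 := by
    intro h; have := congrArg Complex.re h; rw [one_re] at this; linarith
  have hs0 : s ≠ 0 := by rintro rfl; simp at hs; linarith
  have hζ : riemannZeta (s + 1 / 2) ≠ 0 := riemannZeta_ne_zero_of_one_lt_re hsh
  have hld : -deriv riemannZeta (s + 1 / 2) / riemannZeta (s + 1 / 2) =
      (s + 1 / 2 - 1)⁻¹ - logDeriv riemannZeta₁ (s + 1 / 2) := by
    rw [neg_div, ← logDeriv_apply, logDeriv_riemannZeta_eq hs1 hζ]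
    ring
  unfold mellinIoi
  rw [← hld, hint]
  field_simp

/-- `∫_1^∞ (S(x) − 2√x) x^{-(s+1)} dx = −(ζ₁'/ζ₁(s + 1/2) + 2)/s` for `σ > 1`: the main term `2√x`
removes the pole of `−ζ'/ζ(s + 1/2)/s` at `s = 1/2`. [cite: MontgomeryVaughan2007, §15.1 (15.6), shifted] -/
theorem mellinIoi_wpsiErr {s : ℂ} (hs : 1 < s.re) :
    mellinIoi wpsiErr s = -(logDeriv riemannZeta₁ (s + 1 / 2) + 2) / s := by
  have hIw : Integrable (fun x : ℝ ↦ ((wpsi x : ℝ) : ℂ) * (x : ℂ) ^ (-(s + 1)))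
      (volume.restrict (Ioi 1)) := by
    refine integrable_ofReal_mul_cpow_of_re measurable_wpsi ?_
    refine integrableOn_rpow_of_abs_le_mul_self measurable_wpsi (C := Real.log 4 + 4)
      (fun x hx ↦ ?_) hs
    rw [abs_of_nonneg (wpsi_nonneg x)]
    exact wpsi_le x (by linarith)
  have hIm : Integrable (fun x : ℝ ↦ ((2 * x ^ (1 / 2 : ℝ) : ℝ) : ℂ) * (x : ℂ) ^ (-(s + 1)))
      (volume.restrict (Ioi 1)) := by
    refine integrable_ofReal_mul_cpow_of_re
      (show Measurable (fun x : ℝ ↦ 2 * x ^ (1 / 2 : ℝ)) from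
        measurable_const.mul (measurable_id.pow_const _)) ?_
    refine integrableOn_rpow_of_abs_le_mul_self
      (show Measurable (fun x : ℝ ↦ 2 * x ^ (1 / 2 : ℝ)) from
        measurable_const.mul (measurable_id.pow_const _)) (C := 2) (fun x hx ↦ ?_) hs
    have hx0 : 0 < x := by linarith
    have hxh : x ^ (1 / 2 : ℝ) ≤ x := by
      calc x ^ (1 / 2 : ℝ) ≤ x ^ (1 : ℝ) := Real.rpow_le_rpow_of_exponent_le hx.le (by norm_num)
        _ = x := Real.rpow_one x
    rw [abs_of_nonneg (by positivity)]
    linarith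
  have hs0 : s ≠ 0 := by rintro rfl; simp at hs; linarith
  have hs1 : s + 1 / 2 - 1 ≠ 0 := by
    intro h; have := congrArg Complex.re h
    rw [sub_re, re_add_half, one_re, zero_re] at this
    linarith
  have hs2 : s - ((1 / 2 : ℝ) : ℂ) ≠ 0 := by
    intro h; have := congrArg Complex.re h
    simp only [sub_re, ofReal_re, zero_re] at this
    linarith
  unfold wpsiErr
  rw [Nicolas.mellinIoi_sub' hIw hIm, Nicolas.mellinIoi_const_mul, mellinIoi_wpsi hs,
    PsiOmega.mellinIoi_rpow (b := 1 / 2) (by linarith : (1 / 2 : ℝ) < s.re)]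
  have h12 : ((1 / 2 : ℝ) : ℂ) = 1 / 2 := by norm_num
  rw [h12] at hs2
  rw [h12, show s + 1 / 2 - 1 = s - 1 / 2 by ring]
  set L := logDeriv riemannZeta₁ (s + 1 / 2) with hL
  have h3 : -1 + s * 2 ≠ 0 := by
    intro h; apply hs2; linear_combination h / 2
  have h4 : s * 2 - 1 ≠ 0 := by
    intro h; apply hs2; linear_combination h / 2
  push_cast
  field_simp
  ring

/-! ## §3 The comparison function and its continuation (MV §15.1 with the shift `s ↦ s + 1/2`) -/

namespace WeightedLandau

/-- `A(x) = c x^b − η (S(x) − 2√x)`. [cite: MontgomeryVaughan2007, §15.1 (proof of Thm. 15.3)] -/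
def cmpFnW (c b η : ℝ) (x : ℝ) : ℝ := c * x ^ b - η * wpsiErr x

/-- `A` is measurable. [folklore] -/
theorem measurable_cmpFnW (c b η : ℝ) : Measurable (cmpFnW c b η) :=
  (measurable_const.mul (measurable_id.pow_const _)).sub (measurable_const.mul measurable_wpsiErr)

/-- `|A(x)| ≤ (c + log 4 + 6) x` on `(1, ∞)`. [folklore] -/
theorem abs_cmpFnW_le {c b η : ℝ} (hc : 0 ≤ c) (hb : b ≤ 1) (hη : η = 1 ∨ η = -1) {x : ℝ}
    (hx : 1 < x) : |cmpFnW c b η x| ≤ (c + (Real.log 4 + 6)) * x := by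
  have hx0 : 0 < x := by linarith
  have hηabs : |η| = 1 := by rcases hη with rfl | rfl <;> norm_num
  have hxb : x ^ b ≤ x := by
    calc x ^ b ≤ x ^ (1 : ℝ) := Real.rpow_le_rpow_of_exponent_le hx.le hb
      _ = x := Real.rpow_one x
  unfold cmpFnW
  calc |c * x ^ b - η * wpsiErr x|
      ≤ |c * x ^ b| + |η * wpsiErr x| := abs_sub _ _
    _ = c * x ^ b + |wpsiErr x| := by
        rw [abs_mul, abs_mul, hηabs, one_mul, abs_of_nonneg hc,
          abs_of_nonneg (Real.rpow_nonneg hx0.le _)]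
    _ ≤ c * x + (Real.log 4 + 6) * x :=
        add_le_add (mul_le_mul_of_nonneg_left hxb hc) (abs_wpsiErr_le hx)
    _ = (c + (Real.log 4 + 6)) * x := by ring

/-- The shifted kernel `(ζ₁'/ζ₁(s + 1/2) + 2)/s = −∫_1^∞ (S(x) − 2√x) x^{-s-1} dx`.
[cite: MontgomeryVaughan2007, §15.1 (15.6), shifted] -/
def kernelW (s : ℂ) : ℂ := (logDeriv riemannZeta₁ (s + 1 / 2) + 2) / s

/-- The shifted kernel is holomorphic off `s = 0` and off the zeros of `ζ₁(s + 1/2)`.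
[cite: MontgomeryVaughan2007, §15.1] -/
theorem differentiableAt_kernelW {s : ℂ} (hs0 : s ≠ 0) (hζ : riemannZeta₁ (s + 1 / 2) ≠ 0) :
    DifferentiableAt ℂ kernelW s := by
  unfold kernelW
  have h1 : DifferentiableAt ℂ (fun z : ℂ ↦ logDeriv riemannZeta₁ (z + 1 / 2)) s :=
    (PsiOneExplicit.analyticAt_logDeriv_riemannZeta₁ hζ).differentiableAt.comp s
      (differentiableAt_id.add_const _)
  exact (h1.add_const 2).div differentiableAt_id hs0

/-- The continuation `Φ(s) = c/(s − b) + η (ζ₁'/ζ₁(s + 1/2) + 2)/s` of the transform of `A`.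
[cite: MontgomeryVaughan2007, §15.1 (15.6), shifted] -/
def contW (c b η : ℝ) (s : ℂ) : ℂ := c / (s - b) + η * kernelW s

/-- `Φ` is holomorphic off `s = b`, `s = 0` and the zeros of `ζ₁(s + 1/2)`.
[cite: MontgomeryVaughan2007, §15.1] -/
theorem differentiableAt_contW {c b η : ℝ} {s : ℂ} (hsb : s ≠ b) (hs0 : s ≠ 0)
    (hζ : riemannZeta₁ (s + 1 / 2) ≠ 0) : DifferentiableAt ℂ (contW c b η) s := by
  unfold contW
  have d1 : DifferentiableAt ℂ (fun z : ℂ ↦ (c : ℂ) / (z - b)) s :=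
    (differentiableAt_const _).div (differentiableAt_id.sub_const _) (sub_ne_zero.2 hsb)
  exact d1.add ((differentiableAt_kernelW hs0 hζ).const_mul _)

/-- **(15.6), shifted, on the half-plane of absolute convergence**: for `Re s > 1`,
`∫_1^∞ A(x) x^{-s-1} dx = c/(s − b) + η (ζ₁'/ζ₁(s + 1/2) + 2)/s`.
[cite: MontgomeryVaughan2007, §15.1 (15.6)] -/
theorem mellinIoi_cmpFnW {c b η : ℝ} (hb : b < 1) {s : ℂ} (hs : 1 < s.re) :
    mellinIoi (cmpFnW c b η) s = contW c b η s := by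
  have hIpow : Integrable (fun x : ℝ ↦ ((c * x ^ b : ℝ) : ℂ) * (x : ℂ) ^ (-(s + 1)))
      (volume.restrict (Ioi 1)) := by
    refine integrable_ofReal_mul_cpow_of_re
      (show Measurable (fun x : ℝ ↦ c * x ^ b) from measurable_const.mul (measurable_id.pow_const _)) ?_
    have h := Nicolas.integrableOn_const_mul_rpow c
      (Nicolas.integrableOn_rpow_neg_rpow (b := -b) (σ := s.re) (by linarith))
    refine h.congr_fun (fun x _ ↦ ?_) measurableSet_Ioi
    simp only [neg_neg]
  have hIE : Integrable (fun x : ℝ ↦ ((η * wpsiErr x : ℝ) : ℂ) * (x : ℂ) ^ (-(s + 1)))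
      (volume.restrict (Ioi 1)) := by
    refine integrable_ofReal_mul_cpow_of_re
      (show Measurable (fun x : ℝ ↦ η * wpsiErr x) from measurable_const.mul measurable_wpsiErr) ?_
    refine Nicolas.integrableOn_const_mul_rpow η ?_
    exact integrableOn_rpow_of_abs_le_mul_self measurable_wpsiErr (fun x hx ↦ abs_wpsiErr_le hx) hs
  unfold cmpFnW contW kernelW
  rw [Nicolas.mellinIoi_sub' hIpow hIE, Nicolas.mellinIoi_const_mul, Nicolas.mellinIoi_const_mul,
    mellinIoi_wpsiErr hs, PsiOmega.mellinIoi_rpow (lt_trans hb hs)]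
  ring

end WeightedLandau

end Summit.RiemannHypothesis.RiemannHypothesis.Theorems.PfPersistenceDilatingLandauWeightedMellin

end
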